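import Literature.Analysis.FunctionSpaces.TorusRieszTransformProofs
import HarnessLib

/-!
# The Calderón–Zygmund Hessian bound on `T^d` is monotone in the dimension

Analysis/FunctionSpaces proof file; sibling of `TorusRieszTransform` (the named fact
`Literature.Analysis.FunctionSpaces.Torus.eLpNorm_hessian_le_laplacian d`: Robinson–Rodrigo–Sadowski
2016, App. B Thm. B.7 — `‖∂ⱼ∂ₖw‖_{L^p(T^d)} ≤ C‖Δw‖_{L^p(T^d)}`, `1 < p < ∞`, smooth real `w`) and
of `TorusRieszTransformProofs` (the fact on `T^d` from the whole-space bound on `ℝ^d`, and the case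
`𝕋³` unconditionally, `Torus.eLpNorm_hessian_le_laplacian_holds_fin3`).

This file PROVES that the fact descends along coordinate embeddings: if `ι : d ↪ d'` and the bound
holds on `T^{d'}`, it holds on `T^d` with the same constant
(`Torus.eLpNorm_hessian_le_laplacian_of_injective`), hence for every index type of cardinality
at most three unconditionally (`Torus.eLpNorm_hessian_le_laplacian_of_card_le_three`: the circle
`𝕋¹` and the two-dimensional torus `𝕋²`, the setting of two-dimensional turbulence, besides `𝕋³`).

## The argument (functions of fewer variables)

Pull a smooth `w : T^d → ℝ` back along the coordinate restriction
`Torus.restrictCoords ι : T^{d'} → T^d`, `x ↦ (x_{ι j})ⱼ`, to `W = w ∘ restrictCoords ι`, a smooth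
function on `T^{d'}` not depending on the coordinates off the range of `ι`. Then
`∂_{ι j} W = (∂ⱼ w) ∘ restrictCoords ι`, `∂ₘ W = 0` for `m ∉ range ι`, so
`∂_{ι j}∂_{ι k} W = (∂ⱼ∂ₖ w) ∘ restrictCoords ι` and `ΔW = (Δw) ∘ restrictCoords ι`; and
`restrictCoords ι` pushes the Haar probability measure of `T^{d'}` to that of `T^d` (a coordinate
projection of a product of probability measures), so all `L^p` norms agree:
`‖∂ⱼ∂ₖw‖_p = ‖∂_{ιj}∂_{ιk}W‖_p ≤ C‖ΔW‖_p = C‖Δw‖_p`.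

## References

* J. C. Robinson, J. L. Rodrigo, W. Sadowski, *The Three-Dimensional Navier–Stokes Equations*,
  CUP 2016, App. B, Thm. B.7 (pp. 385–386). [RobinsonRodrigoSadowskiCUP2016]
* L. Grafakos, *Classical Fourier Analysis*, 3rd ed. (2014), §3.1.1 (the torus `𝕋ⁿ`, its Haar
  measure as the product of the normalised measures of the factors). [Grafakos2014]

## Mathlib / tree

Mathlib: `Measure.pi_eq`, `Measure.pi_pi`, `eLpNorm_comp_measurePreserving`,
`Function.Embedding.nonempty_iff_card_le` (used). Tree: `TorusCalculusProofs`
(`laplacian_eq_sum_partialDeriv_partialDeriv`), `TorusRieszTransformProofs`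
(`eLpNorm_hessian_le_laplacian_holds_fin3`).
-/

noncomputable section

open MeasureTheory Set Function
open scoped ENNReal NNReal ContDiff

namespace Literature.Analysis.FunctionSpaces

namespace Torus

variable {d d' : Type*}

/-! ### Coordinate restriction between tori -/

section Restrict

/-- **Coordinate restriction** along `ι : d → d'`: the map `T^{d'} → T^d`, `x ↦ (x (ι j))ⱼ`
(for injective `ι`, the projection of `T^{d'} ≅ T^d × T^{d' ∖ ι(d)}` onto the first factor). [folklore] -/
def restrictCoords (ι : d → d') (x : UnitAddTorus d') : UnitAddTorus d := fun j => x (ι j)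

/-- Unfolding `restrictCoords`. [folklore] -/
@[simp]
theorem restrictCoords_apply (ι : d → d') (x : UnitAddTorus d') (j : d) : restrictCoords ι x j = x (ι j) :=
  rfl

/-- `restrictCoords` is additive. [folklore] -/
theorem restrictCoords_add (ι : d → d') (x y : UnitAddTorus d') :
    restrictCoords ι (x + y) = restrictCoords ι x + restrictCoords ι y :=
  rfl

/-- The Euclidean coordinate restriction `ℝ^{d'} → ℝ^d`, `y ↦ (y (ι j))ⱼ`. [folklore] -/
def restrictCoordsE (ι : d → d') (y : EuclideanSpace ℝ d') : EuclideanSpace ℝ d :=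
  WithLp.toLp 2 fun j => y (ι j)

/-- Unfolding `restrictCoordsE`. [folklore] -/
@[simp]
theorem restrictCoordsE_apply (ι : d → d') (y : EuclideanSpace ℝ d') (j : d) :
    restrictCoordsE ι y j = y (ι j) :=
  rfl

variable [Fintype d] [Fintype d']

/-- The Euclidean coordinate restriction as a continuous linear map. [folklore] -/
def restrictCoordsL (ι : d → d') : EuclideanSpace ℝ d' →L[ℝ] EuclideanSpace ℝ d :=
  (EuclideanSpace.equiv d ℝ).symm.toContinuousLinearMap.comp
    (ContinuousLinearMap.pi fun j => EuclideanSpace.proj (ι j))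

omit [Fintype d] [Fintype d'] in
/-- The continuous linear map is the coordinate restriction. [folklore] -/
@[simp]
theorem restrictCoordsL_apply (ι : d → d') (y : EuclideanSpace ℝ d') :
    restrictCoordsL ι y = restrictCoordsE ι y := by
  ext j
  simp [restrictCoordsL, restrictCoordsE]

omit [Fintype d] [Fintype d'] in
/-- `restrictCoords` and the covering maps: `restrictCoords ι (proj y) = proj (restrictCoordsE ι y)`. [folklore] -/
theorem restrictCoords_proj (ι : d → d') (y : EuclideanSpace ℝ d') :
    restrictCoords ι (proj y) = proj (restrictCoordsE ι y) := by
  funext j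
  simp [proj_apply]

omit [Fintype d] [Fintype d'] in
/-- The lift of a pulled-back function is the pull-back of the lift. [folklore] -/
theorem lift_comp_restrictCoords {F : Type*} (w : UnitAddTorus d → F) (ι : d → d') :
    lift (w ∘ restrictCoords ι) = lift w ∘ restrictCoordsE ι := by
  funext y
  simp only [lift_apply, comp_apply, restrictCoords_proj]

/-- Pull-backs of smooth functions along coordinate restrictions are smooth. [folklore] -/
theorem IsSmooth.comp_restrictCoords {F : Type*} [NormedAddCommGroup F] [NormedSpace ℝ F]
    {w : UnitAddTorus d → F} (hw : IsSmooth w) (ι : d → d') : IsSmooth (w ∘ restrictCoords ι) := by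
  unfold IsSmooth
  rw [lift_comp_restrictCoords]
  have hL : ContDiff ℝ ∞ (restrictCoordsE (d := d) ι) := by
    have : (restrictCoordsE (d := d) ι) = fun y => restrictCoordsL ι y := by
      funext y; rw [restrictCoordsL_apply]
    rw [this]
    exact (restrictCoordsL ι).contDiff
  exact hw.comp hL

variable [DecidableEq d] [DecidableEq d']

omit [Fintype d] [Fintype d'] in
/-- The restriction of the basis vector `e_{ι j}` is `e_j` (for injective `ι`). [folklore] -/
theorem restrictCoordsE_single {ι : d → d'} (hι : Injective ι) (j : d) (t : ℝ) :
    restrictCoordsE ι (t • EuclideanSpace.single (ι j) (1 : ℝ)) = t • EuclideanSpace.single j (1 : ℝ) := by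
  ext j'
  simp [hι.eq_iff]

omit [Fintype d] [Fintype d'] [DecidableEq d] in
/-- The restriction of a basis vector `eₘ` with `m` off the range of `ι` vanishes. [folklore] -/
theorem restrictCoordsE_single_of_not_mem {ι : d → d'} {m : d'} (hm : m ∉ Set.range ι) (t : ℝ) :
    restrictCoordsE ι (t • EuclideanSpace.single m (1 : ℝ)) = 0 := by
  ext j'
  have : ι j' ≠ m := fun h => hm ⟨j', h⟩
  simp [this]

omit [Fintype d] [Fintype d'] in
/-- **First derivatives of a pull-back, on the range:** `∂_{ι j} (w ∘ restrictCoords ι) = (∂ⱼ w) ∘ restrictCoords ι`. [folklore] -/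
theorem partialDeriv_comp_restrictCoords {F : Type*} [NormedAddCommGroup F] [NormedSpace ℝ F]
    (w : UnitAddTorus d → F) {ι : d → d'} (hι : Injective ι) (j : d) :
    partialDeriv (ι j) (w ∘ restrictCoords ι) = partialDeriv j w ∘ restrictCoords ι := by
  funext x
  simp only [comp_apply, partialDeriv, Torus.lineDeriv]
  congr 1
  funext t
  rw [restrictCoords_add, restrictCoords_proj, restrictCoordsE_single hι]

omit [Fintype d] [Fintype d'] [DecidableEq d] in
/-- **First derivatives of a pull-back, off the range, vanish.** [folklore] -/
theorem partialDeriv_comp_restrictCoords_of_not_mem {F : Type*} [NormedAddCommGroup F] [NormedSpace ℝ F]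
    (w : UnitAddTorus d → F) {ι : d → d'} {m : d'} (hm : m ∉ Set.range ι) :
    partialDeriv m (w ∘ restrictCoords ι) = fun _ => 0 := by
  funext x
  simp only [comp_apply, partialDeriv, Torus.lineDeriv]
  have : (fun t : ℝ => w (restrictCoords ι (x + proj (t • EuclideanSpace.single m (1 : ℝ))))) =
      fun _ => w (restrictCoords ι x) := by
    funext t
    rw [restrictCoords_add, restrictCoords_proj, restrictCoordsE_single_of_not_mem hm, proj_zero, add_zero]
  rw [this, deriv_const]

omit [Fintype d] [Fintype d'] in
/-- **Second derivatives of a pull-back:** `∂_{ι j}∂_{ι k} (w ∘ restrictCoords ι) = (∂ⱼ∂ₖ w) ∘ restrictCoords ι`. [folklore] -/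
theorem partialDeriv_partialDeriv_comp_restrictCoords {F : Type*} [NormedAddCommGroup F] [NormedSpace ℝ F]
    (w : UnitAddTorus d → F) {ι : d → d'} (hι : Injective ι) (j k : d) :
    partialDeriv (ι j) (partialDeriv (ι k) (w ∘ restrictCoords ι)) =
      partialDeriv j (partialDeriv k w) ∘ restrictCoords ι := by
  rw [partialDeriv_comp_restrictCoords w hι k, partialDeriv_comp_restrictCoords _ hι j]

omit [Fintype d'] [DecidableEq d] in
/-- Partial derivatives of the zero function vanish. [folklore] -/
theorem partialDeriv_fun_zero {F : Type*} [NormedAddCommGroup F] [NormedSpace ℝ F] (m : d') :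
    partialDeriv m (fun _ : UnitAddTorus d' => (0 : F)) = fun _ => 0 := by
  funext x
  simp [partialDeriv, Torus.lineDeriv]

/-- **The Laplacian of a pull-back:** `Δ(w ∘ restrictCoords ι) = (Δw) ∘ restrictCoords ι` for smooth `w`. [folklore] -/
theorem laplacian_comp_restrictCoords {F : Type*} [NormedAddCommGroup F] [NormedSpace ℝ F]
    {w : UnitAddTorus d → F} (hw : IsSmooth w) {ι : d → d'} (hι : Injective ι) :
    Torus.laplacian (w ∘ restrictCoords ι) = Torus.laplacian w ∘ restrictCoords ι := by
  funext x
  rw [laplacian_eq_sum_partialDeriv_partialDeriv (hw.comp_restrictCoords ι), comp_apply,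
    laplacian_eq_sum_partialDeriv_partialDeriv hw]
  -- the terms off the range of `ι` vanish
  set ιe : d ↪ d' := ⟨ι, hι⟩ with hιe
  have hoff : ∀ m ∈ (Finset.univ : Finset d'), m ∉ Finset.univ.map ιe →
      partialDeriv m (partialDeriv m (w ∘ restrictCoords ι)) x = 0 := by
    intro m _ hm
    have hm' : m ∉ Set.range ι := by
      rintro ⟨j, rfl⟩
      exact hm (Finset.mem_map.2 ⟨j, Finset.mem_univ _, rfl⟩)
    rw [partialDeriv_comp_restrictCoords_of_not_mem w hm', partialDeriv_fun_zero]
  rw [← Finset.sum_subset (Finset.subset_univ _) hoff, Finset.sum_map]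
  refine Finset.sum_congr rfl fun j _ => ?_
  show partialDeriv (ι j) (partialDeriv (ι j) (w ∘ restrictCoords ι)) x = _
  rw [partialDeriv_partialDeriv_comp_restrictCoords w hι j j, comp_apply]

end Restrict

/-! ### Coordinate restriction preserves the Haar probability measures -/

section Measure

variable [Fintype d] [Fintype d']

omit [Fintype d] [Fintype d'] in
/-- `restrictCoords` is measurable. [folklore] -/
theorem measurable_restrictCoords (ι : d → d') : Measurable (restrictCoords (d := d) (d' := d') ι) :=
  measurable_pi_lambda _ fun j => measurable_pi_apply (ι j)

/-- **A coordinate projection of a product of probability measures is the product of the selected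
factors** (Grafakos, §3.1.1: the Haar measure of `𝕋ⁿ` is the product of the normalised measures). [folklore] -/
theorem map_restrictCoords_volume {ι : d → d'} (hι : Injective ι) :
    Measure.map (restrictCoords ι) (volume : Measure (UnitAddTorus d')) = (volume : Measure (UnitAddTorus d)) := by
  classical
  have hv : (volume : Measure (UnitAddTorus d)) = Measure.pi fun _ : d => (volume : Measure UnitAddCircle) := rfl
  have hv' : (volume : Measure (UnitAddTorus d')) = Measure.pi fun _ : d' => (volume : Measure UnitAddCircle) := rfl
  rw [hv, hv']
  symm
  refine Measure.pi_eq fun s hs => ?_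
  rw [Measure.map_apply (measurable_restrictCoords ι) (MeasurableSet.univ_pi hs)]
  -- the preimage of a box is a box with full sides off the range of `ι`
  have hpre : restrictCoords ι ⁻¹' Set.pi univ s = Set.pi univ (Function.extend ι s fun _ => univ) := by
    ext x
    simp only [mem_preimage, mem_univ_pi, restrictCoords_apply]
    constructor
    · intro h m
      by_cases hm : ∃ j, ι j = m
      · obtain ⟨j, rfl⟩ := hm
        rw [hι.extend_apply]
        exact h j
      · rw [Function.extend_apply' _ _ _ hm]
        exact mem_univ _
    · intro h j
      have := h (ι j)
      rwa [hι.extend_apply] at this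
  rw [hpre, Measure.pi_pi]
  set ιe : d ↪ d' := ⟨ι, hι⟩ with hιe
  have hone : ∀ m ∈ (Finset.univ : Finset d'), m ∉ Finset.univ.map ιe →
      (volume : Measure UnitAddCircle) (Function.extend ι s (fun _ => univ) m) = 1 := by
    intro m _ hm
    have hm' : ¬∃ j, ι j = m := by
      rintro ⟨j, rfl⟩
      exact hm (Finset.mem_map.2 ⟨j, Finset.mem_univ _, rfl⟩)
    rw [Function.extend_apply' _ _ _ hm', measure_univ]
  rw [← Finset.prod_subset (Finset.subset_univ _) hone, Finset.prod_map]
  refine Finset.prod_congr rfl fun j _ => ?_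
  show (volume : Measure UnitAddCircle) (Function.extend ι s (fun _ => univ) (ι j)) = _
  rw [hι.extend_apply]

/-- **Coordinate restriction is measure preserving** between the Haar probability measures. [folklore] -/
theorem measurePreserving_restrictCoords {ι : d → d'} (hι : Injective ι) :
    MeasurePreserving (restrictCoords ι) (volume : Measure (UnitAddTorus d')) (volume : Measure (UnitAddTorus d)) :=
  ⟨measurable_restrictCoords ι, map_restrictCoords_volume hι⟩

/-- `L^p` norms are invariant under pull-back along a coordinate restriction. [folklore] -/
theorem eLpNorm_comp_restrictCoords {F : Type*} [NormedAddCommGroup F] {f : UnitAddTorus d → F}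
    (hf : AEStronglyMeasurable f volume) {ι : d → d'} (hι : Injective ι) (p : ℝ≥0∞) :
    eLpNorm (f ∘ restrictCoords ι) p (volume : Measure (UnitAddTorus d')) = eLpNorm f p volume :=
  eLpNorm_comp_measurePreserving hf (measurePreserving_restrictCoords hι)

end Measure

/-! ### The fact descends along coordinate embeddings -/

section Descend

variable [Fintype d] [Fintype d']

/-- **The Calderón–Zygmund Hessian bound descends along coordinate embeddings:** if `ι : d → d'` is
injective and `‖∂ⱼ∂ₖW‖_{L^p(T^{d'})} ≤ C‖ΔW‖_{L^p(T^{d'})}` for smooth `W` on `T^{d'}`, then the same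
bound, with the same constant, holds on `T^d` (apply it to `W = w ∘ restrictCoords ι`).
[cite: RobinsonRodrigoSadowskiCUP2016, App. B Thm. B.7 (pp. 385–386)] -/
theorem eLpNorm_hessian_le_laplacian_of_injective {ι : d → d'} (hι : Injective ι)
    (h : eLpNorm_hessian_le_laplacian d') : eLpNorm_hessian_le_laplacian d := by
  classical
  intro _ p hp1 hp
  obtain ⟨C, hC⟩ := h p hp1 hp
  refine ⟨C, fun w hw j k => ?_⟩
  have hW : IsSmooth (w ∘ restrictCoords ι) := hw.comp_restrictCoords ι
  have h1 : eLpNorm (partialDeriv j (partialDeriv k w)) p volume =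
      eLpNorm (partialDeriv (ι j) (partialDeriv (ι k) (w ∘ restrictCoords ι))) p
        (volume : Measure (UnitAddTorus d')) := by
    rw [partialDeriv_partialDeriv_comp_restrictCoords w hι j k,
      eLpNorm_comp_restrictCoords ((hw.partialDeriv k).partialDeriv j).continuous.aestronglyMeasurable hι]
  have h2 : eLpNorm (Torus.laplacian (w ∘ restrictCoords ι)) p (volume : Measure (UnitAddTorus d')) =
      eLpNorm (Torus.laplacian w) p volume := by
    rw [laplacian_comp_restrictCoords hw hι, eLpNorm_comp_restrictCoords hw.laplacian.continuous.aestronglyMeasurable hι]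
  rw [h1, ← h2]
  exact hC _ hW (ι j) (ι k)

omit [Fintype d'] in
/-- The bound descends to index types of no larger cardinality. [cite: RobinsonRodrigoSadowskiCUP2016, App. B Thm. B.7 (pp. 385–386)] -/
theorem eLpNorm_hessian_le_laplacian_of_card_le [Fintype d'] (hcard : Fintype.card d ≤ Fintype.card d')
    (h : eLpNorm_hessian_le_laplacian d') : eLpNorm_hessian_le_laplacian d := by
  obtain ⟨ι⟩ := Function.Embedding.nonempty_iff_card_le.2 hcard
  exact eLpNorm_hessian_le_laplacian_of_injective ι.injective h

/-- **The Calderón–Zygmund Hessian bound on tori of dimension at most three, proved** (`𝕋¹`, `𝕋²`,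
`𝕋³` and every index type of cardinality `≤ 3`): from the three-dimensional torus
(`eLpNorm_hessian_le_laplacian_holds_fin3`) by descent along a coordinate embedding into `Fin 3`.
[cite: RobinsonRodrigoSadowskiCUP2016, App. B Thm. B.7 (pp. 385–386)] -/
theorem eLpNorm_hessian_le_laplacian_of_card_le_three (hcard : Fintype.card d ≤ 3) :
    eLpNorm_hessian_le_laplacian d :=
  eLpNorm_hessian_le_laplacian_of_card_le (d' := Fin 3) (by simpa using hcard)
    eLpNorm_hessian_le_laplacian_holds_fin3

/-- The two-dimensional torus `𝕋²`. [cite: RobinsonRodrigoSadowskiCUP2016, App. B Thm. B.7 (pp. 385–386)] -/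
theorem eLpNorm_hessian_le_laplacian_holds_fin2 : eLpNorm_hessian_le_laplacian (Fin 2) :=
  eLpNorm_hessian_le_laplacian_of_card_le_three (by simp)

end Descend

end Torus

end Literature.Analysis.FunctionSpaces
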